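import Literature.Geometry.Riemannian.CutLocusGeodesic
import Literature.Geometry.Riemannian.ExpMapGlobalSmooth
import Literature.Geometry.Riemannian.GeodesicBallsMetric
import Literature.Geometry.Riemannian.SegmentsAreGeodesics
import Literature.Geometry.Riemannian.GaussLemma
import Literature.Topology.FourManifolds.WhitneyModelChart
import Literature.Geometry.Manifold.InverseFunctionTheorem
import HarnessLib

/-!
# A radial isometry from the tangent space is the exponential map
(synthetic normal coordinates; the interface between Weinstein's construction and his step (4))

Topic `Geometry/Riemannian`; seventh support file of the programme towards the named fact
`Weinstein1968_exists_metric_two_le_multiplicity_of_mem_cutLocus` (`WeinsteinCutLocus.lean`).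
Weinstein's construction (steps (1)–(3) of the proof, zbMATH 0159.23902) produces the new metric
inside the disk `D` TOGETHER WITH its polar structure: a map `F` from the closed unit ball of
`T_pM` onto `D` along which the metric has the Gauss-lemma form `dr² + h_r` ("`exp_p` is a
diffeomorphism of the unit ball onto `D`"). This file proves the fact that makes such a
description usable without ever computing a Christoffel symbol of the new metric:

**A radial isometry is the exponential map.** Let `g` be a smooth Riemannian metric with complete
Levi-Civita connection on a Hausdorff manifold without boundary, `p ∈ M`, and `F : T_pM → M`
(`T_pM` read as the model space `E`) with, on the open `g_p`-ball `B = {g_p(v,v) < r₁²}`: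
`F` is `C^∞` on `B`, `F 0 = p`, `dF_0 = id`, `F` is injective on `B` with injective
differentials, and the two Gauss-lemma identities hold —
`g(dF_v v, dF_v v) = g_p(v, v)` (radial lines have the right speed) and
`g_p(v, β) = 0 ⇒ g(dF_v v, dF_v β) = 0` (radial lines are `g`-orthogonal to the images of the
`g_p`-spheres). Then for every `v ∈ B`:

* `riemannianExpMap_eq_of_radial` — **`exp_p v = F v`**;
* `isMinimizingUpTo_of_radial` — `γ_v|[0, 1]` is minimizing (`d(p, F v) = |v|_{g_p}`);
* `mfderiv_riemannianExpMap_eq_of_radial` — `d(exp_p)_v = dF_v` (in particular injective: no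
  conjugate vector in `B`);
* `edist_eq_of_radial` — `d(p, F v) = |v|_{g_p}` (needs neither `dF_0 = id` nor completeness).

Proof (Lee 2018, Prop. 6.11–Cor. 6.13 and Thm. 6.4, as vendored): by the abstract form of
"radial geodesics minimize" (`GeodesicBallsMetric.edist_eq_of_mem_ball`, which needs exactly the
two Gauss identities and a `C¹` inverse of `F` on the open image — supplied by the inverse function
theorem and `exists_chart_of_injOn_of_isLocalDiffeomorphAt`) one has `d(p, F w) = |w|` on `B`; hence
for a unit `u` the radial curve `σ(t) = F(t u)` is a unit-speed metric segment on `[0, ℓ]`,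
`ℓ < r₁` (`d(σ s, σ t) = |s - t|`: `≤` by the length of `σ`, `≥` by the triangle inequality), so by
"segments are geodesics" (`segment_eq_maximalGeodesic`) it is a geodesic; its tangent lift at
`t = 0` is `(p, u)` (continuity of the bundled derivative of `F`), so `σ = γ_u` and
`F(t u) = exp_p(t u)`.

The companion file `WeinsteinCriterion.lean` feeds this into Weinstein's step (4): there the
hypotheses "(ball)" (radial segments minimize up to radius `R`, no conjugate vector on the
`R`-sphere) and "(exit)" (convexity of the Jacobi data at the exit sphere) become statements about
`F` alone — the latter in the SCALAR form `-λ f(R) ≤ ½ f'(R)` for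
`f(t) = g(dF_{tu}(t w), dF_{tu}(t w)) = |J(t)|²`, since `g(D_t J, J) = ½ (|J|²)'` by metric
compatibility — so that the remaining burden of Weinstein's theorem is to CONSTRUCT `(g, p, F)`.

No definitions, no named facts (D-0026); theorem-only file.

## References

* A. Weinstein, Ann. of Math. 87 (1968) 29–41, main theorem, steps (3)–(4) of the proof
  [Weinstein1968]; zbMATH Zbl 0159.23902.
* J. M. Lee, *Introduction to Riemannian Manifolds*, 2nd ed. (2018), Thm. 6.4, Thm. 6.9 (Gauss
  lemma), Prop. 6.11, Cor. 6.12–6.13, Prop. 5.19 [LeeRiemannianManifolds2018].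
-/

noncomputable section

open Bundle Set Filter Function MeasureTheory
open scoped Manifold ContDiff Topology

namespace Literature.Geometry.Riemannian

open Literature.Geometry.Lorentzian
open Literature.Geometry.Lorentzian.PseudoRiemannianMetric
open Literature.Geometry.Manifold Literature.Topology.FourManifolds

variable {E : Type*} [NormedAddCommGroup E] [NormedSpace ℝ E] {H : Type*} [TopologicalSpace H]
  {I : ModelWithCorners ℝ E H} {M : Type*} [TopologicalSpace M] [ChartedSpace H M]
  [IsManifold I ∞ M] {n : ℕ∞ω} [FiniteDimensional ℝ E] [CompleteSpace E] [T2Space M]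
  [I.Boundaryless]
  {g : PseudoRiemannianMetric I n E (TangentSpace I : M → Type _)} [g.HasLeviCivita]

/-! ### Small helpers (cross-fibre bookkeeping; private — `val_eq_of_basePoint_eq` also exists in `ConstantCurvatureJacobi.lean`) -/

omit [FiniteDimensional ℝ E] [CompleteSpace E] [T2Space M] [I.Boundaryless] [g.HasLeviCivita] in
/-- Transport of a value of `g` along an equality of base points (the vectors read in `E`).
[folklore] -/
private theorem val_eq_of_basePoint_eq {x y : M} (h : x = y) (a b : E) :
    g.val x a b = g.val y a b := by
  subst h
  rfl

omit [IsManifold I ∞ M] [FiniteDimensional ℝ E] [CompleteSpace E] [T2Space M] [I.Boundaryless] in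
/-- Two points of `TM` with equal base points and equal fibre components (read in `E`) are equal.
[folklore] -/
private theorem totalSpace_mk_eq_of_eq {x y : M} (h : x = y) {a b : E} (hab : a = b) :
    (TotalSpace.mk' E x a : TangentBundle I M) = TotalSpace.mk' E y b := by
  subst h
  subst hab
  rfl

omit [CompleteSpace E] [T2Space M] [I.Boundaryless] in
/-- Maximal geodesics issuing from equal points of `TM` coincide. [folklore] -/
private theorem maximalGeodesic_eq_of_totalSpace_eq (cov : CovariantDerivative I E (TangentSpace I : M → Type _))
    {q q' : TangentBundle I M} (h : q = q') :
    maximalGeodesic cov q.proj q.snd = maximalGeodesic cov q'.proj q'.snd := by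
  subst h
  rfl

/-! ### The radial isometry is the exponential map -/

section Core

variable [CovariantDerivative.ContMDiffCovariantDerivative g.leviCivita 1]

omit [g.HasLeviCivita] [CovariantDerivative.ContMDiffCovariantDerivative g.leviCivita 1] in
/-- **Radial distances under a radial isometry**: in the setting of
`riemannianExpMap_eq_of_radial` (without the hypotheses on `dF_0` and on completeness),
`d(p, F v) = |v|_{g_p}` for `v` in the ball — Lee 2018, Cor. 6.12 in the abstract form
`GeodesicBallsMetric.edist_eq_of_mem_ball`, whose `C¹` inverse of `F` on the open image is supplied
by the inverse function theorem (`isLocalDiffeomorphAt_of_mfderiv`) and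
`exists_chart_of_injOn_of_isLocalDiffeomorphAt`. [cite: LeeRiemannianManifolds2018, Cor. 6.12] -/
theorem edist_eq_of_radial (hg : g.IsRiemannian) {p : M} {F : E → M} {r₁ : ℝ} (hr₁ : 0 < r₁)
    (hFs : ContMDiffOn 𝓘(ℝ, E) I ∞ F {v : E | g.val p v v < r₁ ^ 2})
    (hF0 : F 0 = p)
    (hinj : InjOn F {v : E | g.val p v v < r₁ ^ 2})
    (hdF : ∀ v : E, g.val p v v < r₁ ^ 2 → Injective (mfderiv 𝓘(ℝ, E) I F v))
    (hrad : ∀ v : E, g.val p v v < r₁ ^ 2 →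
      g.val (F v) (mfderiv 𝓘(ℝ, E) I F v v) (mfderiv 𝓘(ℝ, E) I F v v) = g.val p v v)
    (hgauss : ∀ v β : E, g.val p v v < r₁ ^ 2 → g.val p v β = 0 →
      g.val (F v) (mfderiv 𝓘(ℝ, E) I F v v) (mfderiv 𝓘(ℝ, E) I F v β) = 0)
    {v : E} (hv : g.val p v v < r₁ ^ 2) :
    g.edist hg p (F v) = ENNReal.ofReal (Real.sqrt (g.val p v v)) := by
  set G : E →L[ℝ] E →L[ℝ] ℝ := g.val p with hG
  set B : Set E := {v : E | G v v < r₁ ^ 2} with hB_def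
  have hGcont : Continuous fun u : E ↦ G u u := G.continuous₂.comp (continuous_id.prodMk continuous_id)
  have hBo : IsOpen B := isOpen_lt hGcont continuous_const
  /- `F` is a local diffeomorphism on `B`; a `C^∞` inverse on the open image -/
  have hloc : ∀ u ∈ B, IsLocalDiffeomorphAt 𝓘(ℝ, E) I ∞ F u := by
    intro u hu
    set A : E →L[ℝ] E := mfderiv 𝓘(ℝ, E) I F u with hA
    have hAinj : Injective (A : E →ₗ[ℝ] E) := hdF u hu
    set L₀ : E ≃ₗ[ℝ] E := LinearMap.linearEquivOfInjective (A : E →ₗ[ℝ] E) hAinj rfl with hL₀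
    refine isLocalDiffeomorphAt_of_mfderiv (by simp) hBo hu hFs L₀.toContinuousLinearEquiv ?_
    exact ContinuousLinearMap.ext fun w ↦ rfl
  obtain ⟨ψ, hsrc, htgt, hψsymm, hψleft, hψs, -⟩ :=
    exists_chart_of_injOn_of_isLocalDiffeomorphAt (I := 𝓘(ℝ, E)) (J := I) (n := ∞) hBo hloc hinj
  set U : Set M := ψ.source with hU_def
  have hU : IsOpen U := ψ.open_source
  have hLF : ∀ w : E, G w w < r₁ ^ 2 → F w ∈ U ∧ ψ (F w) = w := fun w hw ↦ by
    refine ⟨?_, hψleft w hw⟩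
    have h1 : F w ∈ F '' B := mem_image_of_mem F hw
    rwa [← hsrc] at h1
  have hFL : ∀ q ∈ U, G (ψ q) (ψ q) < r₁ ^ 2 ∧ F (ψ q) = q := by
    intro q hq
    have h1 : ψ q ∈ ψ.target := ψ.map_source hq
    rw [htgt] at h1
    refine ⟨h1, ?_⟩
    rw [← hψsymm]
    exact ψ.left_inv hq
  have hL : ContMDiffOn I 𝓘(ℝ, E) 1 ψ U := hψs.of_le (by simp)
  have hFs1 : ContMDiffOn 𝓘(ℝ, E) I 1 F B := hFs.of_le (by simp)
  exact edist_eq_of_mem_ball (F := F) (L := ψ) hg hr₁ hF0 hU hLF hFL hL hFs1 hrad hgauss hv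

/-- **A radial isometry from `T_pM` is the exponential map** (core form, explicit smoothness and
completeness hypotheses; see the module docstring). For `F : E = T_pM → M`, `C^∞` on the open
`g_p`-ball `B` of radius `r₁`, with `F 0 = p`, `dF_0 = id`, injective on `B` with injective
differentials, and satisfying the Gauss-lemma identities `g(dF_v v, dF_v v) = g_p(v,v)` and
`g_p(v,β) = 0 ⇒ g(dF_v v, dF_v β) = 0` on `B`: `exp_p v = F v` for every `v ∈ B`.
[cite: LeeRiemannianManifolds2018, Prop. 6.11, Cor. 6.12 and Thm. 6.4] -/
theorem riemannianExpMap_eq_of_radial (hn : (∞ : ℕ∞ω) ≤ n) (hg : g.IsRiemannian)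
    (hc : IsGeodesicallyComplete g.leviCivita) {p : M} {F : E → M} {r₁ : ℝ} (hr₁ : 0 < r₁)
    (hFs : ContMDiffOn 𝓘(ℝ, E) I ∞ F {v : E | g.val p v v < r₁ ^ 2})
    (hF0 : F 0 = p)
    (hdF0 : ∀ w : E, mfderiv 𝓘(ℝ, E) I F 0 w = w)
    (hinj : InjOn F {v : E | g.val p v v < r₁ ^ 2})
    (hdF : ∀ v : E, g.val p v v < r₁ ^ 2 → Injective (mfderiv 𝓘(ℝ, E) I F v))
    (hrad : ∀ v : E, g.val p v v < r₁ ^ 2 →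
      g.val (F v) (mfderiv 𝓘(ℝ, E) I F v v) (mfderiv 𝓘(ℝ, E) I F v v) = g.val p v v)
    (hgauss : ∀ v β : E, g.val p v v < r₁ ^ 2 → g.val p v β = 0 →
      g.val (F v) (mfderiv 𝓘(ℝ, E) I F v v) (mfderiv 𝓘(ℝ, E) I F v β) = 0)
    {v : E} (hv : g.val p v v < r₁ ^ 2) :
    riemannianExpMap g p v = F v := by
  -- positive semidefiniteness
  have hnn : ∀ (x : M) (u : TangentSpace I x), 0 ≤ g.val x u u := fun x u ↦ by
    by_cases hu : u = 0
    · subst hu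
      simp
    · exact (hg x u hu).le
  set G : E →L[ℝ] E →L[ℝ] ℝ := g.val p with hG
  set B : Set E := {v : E | G v v < r₁ ^ 2} with hB_def
  have hGcont : Continuous fun u : E ↦ G u u := G.continuous₂.comp (continuous_id.prodMk continuous_id)
  have hBo : IsOpen B := isOpen_lt hGcont continuous_const
  have h0B : (0 : E) ∈ B := by
    show G 0 0 < r₁ ^ 2
    simp only [map_zero]
    positivity
  have hFd : ∀ u ∈ B, MDifferentiableAt 𝓘(ℝ, E) I F u := fun u hu ↦
    ((hFs u hu).contMDiffAt (hBo.mem_nhds hu)).mdifferentiableAt (by simp)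
  -- `d(p, F w) = |w|` on `B`
  have hdist : ∀ w : E, G w w < r₁ ^ 2 →
      g.edist hg p (F w) = ENNReal.ofReal (Real.sqrt (G w w)) := fun w hw ↦
    edist_eq_of_radial hg hr₁ hFs hF0 hinj hdF hrad hgauss hw
  /- the case `v = 0` -/
  by_cases hv0 : v = 0
  · subst hv0
    rw [hF0]
    exact riemannianExpMap_zero g p
  /- `c = |v|`, `u = v / c`, `ℓ ∈ (c, r₁)` -/
  have hvv : 0 < G v v := hg p v hv0
  set c : ℝ := Real.sqrt (G v v) with hc_def
  have hcpos : 0 < c := Real.sqrt_pos.2 hvv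
  have hcne : c ≠ 0 := hcpos.ne'
  have hcsq : c * c = G v v := Real.mul_self_sqrt hvv.le
  have hcr : c < r₁ := by
    have h1 : c * c < r₁ ^ 2 := by rw [hcsq]; exact hv
    nlinarith
  set u : E := c⁻¹ • v with hu_def
  have hcu : c • u = v := by rw [hu_def, smul_inv_smul₀ hcne]
  have hu1 : G u u = 1 := by
    have h1 : G u u = c⁻¹ * c⁻¹ * G v v := by
      rw [hu_def]
      simp only [map_smul, FunLike.coe_smul, Pi.smul_apply, smul_eq_mul]
      ring
    rw [h1, ← hcsq]
    field_simp
  have hGtu : ∀ t : ℝ, G (t • u) (t • u) = t ^ 2 := fun t ↦ by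
    simp only [map_smul, FunLike.coe_smul, Pi.smul_apply, smul_eq_mul, hu1]
    ring
  have hBt : ∀ t : ℝ, |t| < r₁ → G (t • u) (t • u) < r₁ ^ 2 := fun t ht ↦ by
    rw [hGtu]
    exact sq_lt_sq' (by linarith [abs_lt.1 ht |>.1]) (abs_lt.1 ht).2
  set ℓ : ℝ := (c + r₁) / 2 with hℓ_def
  have hcℓ : c < ℓ := by rw [hℓ_def]; linarith
  have hℓr : ℓ < r₁ := by rw [hℓ_def]; linarith
  have hℓpos : 0 < ℓ := hcpos.trans hcℓ
  /- the radial curve `σ(t) = F(t u)`: velocity, speed, length -/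
  set σ : ℝ → M := fun t ↦ F (t • u) with hσ_def
  have hline : ∀ t : ℝ, HasDerivAt (fun t : ℝ ↦ t • u) u t := fun t ↦ by
    simpa using (hasDerivAt_id t).smul_const u
  have hvel : ∀ t : ℝ, |t| < r₁ → velocity I σ t = mfderiv 𝓘(ℝ, E) I F (t • u) u := fun t ht ↦
    velocity_comp_of_hasDerivAt (F := F) (c := fun t : ℝ ↦ t • u) rfl (hFd (t • u) (hBt t ht))
      (hline t)
  have hspeed : ∀ t : ℝ, |t| < r₁ →
      g.val (σ t) (velocity I σ t) (velocity I σ t) = 1 := by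
    intro t ht
    rw [hvel t ht]
    rcases eq_or_ne t 0 with rfl | ht0
    · -- at `t = 0`: `dF_0 u = u` and `F 0 = p`
      show g.val (F ((0 : ℝ) • u)) (mfderiv 𝓘(ℝ, E) I F ((0 : ℝ) • u) u)
        (mfderiv 𝓘(ℝ, E) I F ((0 : ℝ) • u) u) = 1
      rw [zero_smul, hdF0 u, val_eq_of_basePoint_eq (g := g) hF0 u u]
      exact hu1
    · have h := (hrad (t • u) (hBt t ht)).trans (hGtu t)
      have e1 : mfderiv 𝓘(ℝ, E) I F (t • u) ((t • u : E)) = t • mfderiv 𝓘(ℝ, E) I F (t • u) u :=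
        (mfderiv 𝓘(ℝ, E) I F (t • u)).map_smul t u
      rw [e1] at h
      simp only [map_smul, FunLike.coe_smul, Pi.smul_apply, smul_eq_mul] at h
      have h2 : t ^ 2 * g.val (F (t • u)) (mfderiv 𝓘(ℝ, E) I F (t • u) u)
          (mfderiv 𝓘(ℝ, E) I F (t • u) u) = t ^ 2 * 1 :=
        calc t ^ 2 * g.val (F (t • u)) (mfderiv 𝓘(ℝ, E) I F (t • u) u)
              (mfderiv 𝓘(ℝ, E) I F (t • u) u)
            = t * (t * g.val (F (t • u)) (mfderiv 𝓘(ℝ, E) I F (t • u) u)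
                (mfderiv 𝓘(ℝ, E) I F (t • u) u)) := by ring
          _ = t ^ 2 := h
          _ = t ^ 2 * 1 := (mul_one _).symm
      have ht2 : t ^ 2 ≠ 0 := pow_ne_zero 2 ht0
      show g.val (F (t • u)) (mfderiv 𝓘(ℝ, E) I F (t • u) u) (mfderiv 𝓘(ℝ, E) I F (t • u) u) = 1
      exact mul_left_cancel₀ ht2 h2
  -- smoothness of `σ` on `(-r₁, r₁)`
  have hσs : ContMDiffOn 𝓘(ℝ, ℝ) I ∞ σ {t : ℝ | |t| < r₁} := by
    have h1 : ContMDiff 𝓘(ℝ, ℝ) 𝓘(ℝ, E) ∞ (fun t : ℝ ↦ t • u) :=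
      (contDiff_id.smul contDiff_const).contMDiff
    exact hFs.comp h1.contMDiffOn fun t ht ↦ hBt t ht
  -- the length of `σ|[s, t]` is `t - s`
  have hlen : ∀ s t : ℝ, -r₁ < s → s ≤ t → t < r₁ → g.length hg σ s t = ENNReal.ofReal (t - s) := by
    intro s t hs hst ht
    rw [g.length_eq_lintegral hg σ s t]
    have h1 : ∫⁻ r in Icc s t, ENNReal.ofReal (Real.sqrt (g.val (σ r) (mfderiv 𝓘(ℝ, ℝ) I σ r 1)
        (mfderiv 𝓘(ℝ, ℝ) I σ r 1))) = ∫⁻ r in Icc s t, 1 := by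
      refine setLIntegral_congr_fun measurableSet_Icc fun r hr ↦ ?_
      have hr : |r| < r₁ := abs_lt.2 ⟨by linarith [hr.1], by linarith [hr.2]⟩
      have h2 : g.val (σ r) (mfderiv 𝓘(ℝ, ℝ) I σ r 1) (mfderiv 𝓘(ℝ, ℝ) I σ r 1) = 1 := hspeed r hr
      simp only [h2, Real.sqrt_one, ENNReal.ofReal_one]
    rw [h1, setLIntegral_one, Real.volume_Icc]
  -- `d(p, σ t) = t` for `0 ≤ t < r₁`
  have hdσ : ∀ t : ℝ, 0 ≤ t → t < r₁ → g.edist hg p (σ t) = ENNReal.ofReal t := by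
    intro t ht0 ht
    show g.edist hg p (F (t • u)) = ENNReal.ofReal t
    rw [hdist (t • u) (hBt t (by rw [abs_of_nonneg ht0]; exact ht)), hGtu, Real.sqrt_sq ht0]
  -- the segment property on `[0, ℓ]`
  have hseg' : ∀ s t : ℝ, 0 ≤ s → s ≤ t → t ≤ ℓ → g.edist hg (σ s) (σ t) = ENNReal.ofReal (t - s) := by
    intro s t hs hst htℓ
    have htr : t < r₁ := htℓ.trans_lt hℓr
    have hs' : -r₁ < s := by linarith
    refine le_antisymm ?_ ?_
    · have hσst : ContMDiffOn 𝓘(ℝ, ℝ) I 1 σ (Icc s t) := by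
        refine (hσs.of_le (by simp)).mono fun r hr ↦ ?_
        have hr1 : s ≤ r := hr.1
        have hr2 : r ≤ t := hr.2
        show |r| < r₁
        exact abs_lt.2 ⟨by linarith, by linarith⟩
      have h := g.edist_le_length hg hst hσst
      rwa [hlen s t hs' hst htr] at h
    · have htri : g.edist hg p (σ t) ≤ g.edist hg p (σ s) + g.edist hg (σ s) (σ t) :=
        g.edist_triangle hg _ _ _
      rw [hdσ t (hs.trans hst) htr, hdσ s hs (hst.trans_lt htr)] at htri
      rw [ENNReal.ofReal_sub t hs]
      exact tsub_le_iff_left.2 htri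
  have hseg : ∀ s ∈ Icc (0 : ℝ) ℓ, ∀ t ∈ Icc (0 : ℝ) ℓ,
      g.edist hg (σ s) (σ t) = ENNReal.ofReal |s - t| := by
    intro s hs t ht
    rcases le_total s t with hst | hts
    · rw [hseg' s t hs.1 hst ht.2, abs_sub_comm, abs_of_nonneg (sub_nonneg.2 hst)]
    · rw [g.edist_comm hg, hseg' t s ht.1 hts hs.2, abs_of_nonneg (sub_nonneg.2 hts)]
  /- segments are geodesics -/
  obtain ⟨a, -, hσeq⟩ := segment_eq_maximalGeodesic g hn hg hc hseg (t₁ := ℓ / 2)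
    ⟨by linarith, by linarith⟩
  set γa : ℝ → M := maximalGeodesic g.leviCivita (σ (ℓ / 2)) a with hγa_def
  set γs : ℝ → M := fun t ↦ γa (t - ℓ / 2) with hγs_def
  have hγa : IsGeodesic g.leviCivita γa :=
    (maximalGeodesic_of_isGeodesicallyComplete hc (σ (ℓ / 2)) _).2.1
  have hγs : IsGeodesic g.leviCivita γs := by
    have h := IsGeodesicOn.comp_sub_const (hγa.isGeodesicOn univ) (ℓ / 2)
    rwa [preimage_univ] at h
  have hσγ : ∀ t ∈ Icc (0 : ℝ) ℓ, σ t = γs t := fun t ht ↦ hσeq t ht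
  -- the tangent lifts of `σ` and `γs` agree at `t = 0`
  have hLγ : ContinuousAt (tangentLift I γs) 0 := (hγs.1 0 (mem_univ 0)).continuousAt
  have hLσ_eq : ∀ t : ℝ, |t| < r₁ →
      tangentLift I σ t = tangentMap 𝓘(ℝ, E) I F (TotalSpace.mk' E (t • u) u) := by
    intro t ht
    rw [tangentLift, TotalSpace.ext_iff]
    exact ⟨rfl, by rw [hvel t ht]; rfl⟩
  have hLσ : ContinuousAt (tangentLift I σ) 0 := by
    -- the bundled derivative of `F` is continuous on `π⁻¹ B`
    have h1 : ContinuousOn (tangentMapWithin 𝓘(ℝ, E) I F B) (π E (TangentSpace 𝓘(ℝ, E)) ⁻¹' B) :=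
      hFs.continuousOn_tangentMapWithin (by simp) hBo.uniqueMDiffOn
    have h2 : ContinuousOn (tangentMap 𝓘(ℝ, E) I F) (π E (TangentSpace 𝓘(ℝ, E)) ⁻¹' B) := by
      refine h1.congr fun q hq ↦ ?_
      exact (tangentMapWithin_eq_tangentMap (hBo.uniqueMDiffOn _ hq) (hFd _ hq)).symm
    have h3 : ContinuousAt (tangentMap 𝓘(ℝ, E) I F) (TotalSpace.mk' E ((0 : ℝ) • u) u) :=
      h2.continuousAt ((hBo.preimage (FiberBundle.continuous_proj E (TangentSpace 𝓘(ℝ, E)))).mem_nhds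
        (by show G ((0 : ℝ) • u) ((0 : ℝ) • u) < r₁ ^ 2; exact hBt 0 (by simpa using hr₁)))
    have h4 : Continuous fun t : ℝ ↦ (TotalSpace.mk' E (t • u) u : TangentBundle 𝓘(ℝ, E) E) := by
      have h5 : Continuous fun t : ℝ ↦ (tangentBundleModelSpaceHomeomorph 𝓘(ℝ, E)).symm (t • u, u) :=
        (tangentBundleModelSpaceHomeomorph 𝓘(ℝ, E)).symm.continuous.comp
          ((continuous_id.smul continuous_const).prodMk continuous_const)
      exact h5
    have h6 : ContinuousAt (fun t : ℝ ↦ tangentMap 𝓘(ℝ, E) I F (TotalSpace.mk' E (t • u) u)) 0 :=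
      ContinuousAt.comp (f := fun t : ℝ ↦ (TotalSpace.mk' E (t • u) u : TangentBundle 𝓘(ℝ, E) E))
        (x := (0 : ℝ)) h3 h4.continuousAt
    refine h6.congr ?_
    have hnhd : {t : ℝ | |t| < r₁} ∈ 𝓝 (0 : ℝ) :=
      (isOpen_lt continuous_abs continuous_const).mem_nhds (by simpa using hr₁)
    filter_upwards [hnhd] with t ht
    exact (hLσ_eq t ht).symm
  have hLift : tangentLift I σ 0 = tangentLift I γs 0 := by
    haveI : T2Space (TangentBundle I M) := t2Space_totalSpace
    have hev : tangentLift I σ =ᶠ[𝓝[>] (0 : ℝ)] tangentLift I γs := by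
      filter_upwards [Ioo_mem_nhdsGT hℓpos] with t ht
      have hnear : σ =ᶠ[𝓝 t] γs := by
        filter_upwards [Ioo_mem_nhds ht.1 ht.2] with s hs
        exact hσγ s ⟨hs.1.le, hs.2.le⟩
      show (TotalSpace.mk' E (σ t) (velocity I σ t) : TangentBundle I M) =
        TotalSpace.mk' E (γs t) (velocity I γs t)
      exact totalSpace_mk_eq_of_eq (I := I) (hσγ t ⟨ht.1.le, ht.2.le⟩)
        (velocity_congr_of_eventuallyEq hnear)
    exact tendsto_nhds_unique_of_eventuallyEq (hLσ.tendsto.mono_left nhdsWithin_le_nhds)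
      (hLγ.tendsto.mono_left nhdsWithin_le_nhds) hev
  -- hence `(p, u) = (γs 0, γs' 0)` in `TM`
  have hpu : (TotalSpace.mk' E p u : TangentBundle I M) = tangentLift I γs 0 := by
    rw [← hLift, hLσ_eq 0 (by simpa using hr₁)]
    show (TotalSpace.mk' E p u : TangentBundle I M) =
      TotalSpace.mk' E (F ((0 : ℝ) • u)) (mfderiv 𝓘(ℝ, E) I F ((0 : ℝ) • u) u)
    have h1 : F ((0 : ℝ) • u) = p := by rw [zero_smul, hF0]
    have h2 : mfderiv 𝓘(ℝ, E) I F ((0 : ℝ) • u) u = u := by rw [zero_smul, hdF0 u]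
    exact (totalSpace_mk_eq_of_eq (I := I) h1 h2).symm
  -- `γ_u = γs`
  have hγu : ∀ s : ℝ, maximalGeodesic g.leviCivita p u s = γs s := by
    intro s
    have h1 := maximalGeodesic_eq_of_totalSpace_eq g.leviCivita hpu
    have h2 := maximalGeodesic_velocity_apply_of_isGeodesic (cov := g.leviCivita) hγs 0 s
    rw [add_zero] at h2
    exact ((congr_fun h1 s).trans h2)
  /- conclusion -/
  have h1 : riemannianExpMap g p v = maximalGeodesic g.leviCivita p u c := by
    have h := expMap_smul hc p (show TangentSpace I p from u) c
    rw [riemannianExpMap_eq, ← hcu]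
    exact h
  rw [h1, hγu c, ← hσγ c ⟨hcpos.le, hcℓ.le⟩]
  show F (c • u) = F v
  rw [hcu]

/-- **Radial segments of a radial isometry minimize**: in the setting of
`riemannianExpMap_eq_of_radial`, `γ_v|[0, 1]` is minimizing for every `v` in the ball
(`L(γ_v|[0,1]) = |v| = d(p, F v) = d(p, exp_p v)`). [cite: LeeRiemannianManifolds2018, Prop. 6.11] -/
theorem isMinimizingUpTo_of_radial (hn : (∞ : ℕ∞ω) ≤ n) (hg : g.IsRiemannian)
    (hc : IsGeodesicallyComplete g.leviCivita) {p : M} {F : E → M} {r₁ : ℝ} (hr₁ : 0 < r₁)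
    (hFs : ContMDiffOn 𝓘(ℝ, E) I ∞ F {v : E | g.val p v v < r₁ ^ 2})
    (hF0 : F 0 = p)
    (hdF0 : ∀ w : E, mfderiv 𝓘(ℝ, E) I F 0 w = w)
    (hinj : InjOn F {v : E | g.val p v v < r₁ ^ 2})
    (hdF : ∀ v : E, g.val p v v < r₁ ^ 2 → Injective (mfderiv 𝓘(ℝ, E) I F v))
    (hrad : ∀ v : E, g.val p v v < r₁ ^ 2 →
      g.val (F v) (mfderiv 𝓘(ℝ, E) I F v v) (mfderiv 𝓘(ℝ, E) I F v v) = g.val p v v)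
    (hgauss : ∀ v β : E, g.val p v v < r₁ ^ 2 → g.val p v β = 0 →
      g.val (F v) (mfderiv 𝓘(ℝ, E) I F v v) (mfderiv 𝓘(ℝ, E) I F v β) = 0)
    {v : E} (hv : g.val p v v < r₁ ^ 2) :
    IsMinimizingUpTo g hg p v 1 := by
  haveI := fact_one_le_of_infty_le hn
  refine ⟨?_, ?_⟩
  · rw [(maximalGeodesic_of_isGeodesicallyComplete hc p (show TangentSpace I p from v)).1]
    exact subset_univ _
  · rw [length_maximalGeodesic hg hc p (show TangentSpace I p from v) 0 1, sub_zero, one_mul,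
      ← expMap_eq_maximalGeodesic hc p (show TangentSpace I p from v)]
    change _ = g.edist hg p (riemannianExpMap g p v)
    rw [riemannianExpMap_eq_of_radial hn hg hc hr₁ hFs hF0 hdF0 hinj hdF hrad hgauss hv,
      edist_eq_of_radial hg hr₁ hFs hF0 hinj hdF hrad hgauss hv]

/-- **The differential of the exponential map along a radial isometry**: in the setting of
`riemannianExpMap_eq_of_radial`, `d(exp_p)_v = dF_v` for `v` in the ball (the two maps agree on
the open ball); in particular `d(exp_p)_v` is injective there — no conjugate vector in the ball.
[cite: LeeRiemannianManifolds2018, Prop. 6.11 and Prop. 10.20] -/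
theorem mfderiv_riemannianExpMap_eq_of_radial (hn : (∞ : ℕ∞ω) ≤ n) (hg : g.IsRiemannian)
    (hc : IsGeodesicallyComplete g.leviCivita) {p : M} {F : E → M} {r₁ : ℝ} (hr₁ : 0 < r₁)
    (hFs : ContMDiffOn 𝓘(ℝ, E) I ∞ F {v : E | g.val p v v < r₁ ^ 2})
    (hF0 : F 0 = p)
    (hdF0 : ∀ w : E, mfderiv 𝓘(ℝ, E) I F 0 w = w)
    (hinj : InjOn F {v : E | g.val p v v < r₁ ^ 2})
    (hdF : ∀ v : E, g.val p v v < r₁ ^ 2 → Injective (mfderiv 𝓘(ℝ, E) I F v))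
    (hrad : ∀ v : E, g.val p v v < r₁ ^ 2 →
      g.val (F v) (mfderiv 𝓘(ℝ, E) I F v v) (mfderiv 𝓘(ℝ, E) I F v v) = g.val p v v)
    (hgauss : ∀ v β : E, g.val p v v < r₁ ^ 2 → g.val p v β = 0 →
      g.val (F v) (mfderiv 𝓘(ℝ, E) I F v v) (mfderiv 𝓘(ℝ, E) I F v β) = 0)
    {v : E} (hv : g.val p v v < r₁ ^ 2) :
    mfderiv 𝓘(ℝ, E) I (fun w : E ↦ riemannianExpMap g p (show TangentSpace I p from w)) v =
      mfderiv 𝓘(ℝ, E) I F v := by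
  set G : E →L[ℝ] E →L[ℝ] ℝ := g.val p with hG
  have hGcont : Continuous fun u : E ↦ G u u := G.continuous₂.comp (continuous_id.prodMk continuous_id)
  have hBo : IsOpen {v : E | G v v < r₁ ^ 2} := isOpen_lt hGcont continuous_const
  refine Filter.EventuallyEq.mfderiv_eq ?_
  filter_upwards [hBo.mem_nhds hv] with w hw
  exact riemannianExpMap_eq_of_radial hn hg hc hr₁ hFs hF0 hdF0 hinj hdF hrad hgauss hw

end Core

end Literature.Geometry.Riemannian

end
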